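import Summits.RiemannHypothesis.RiemannHypothesis.Theorems.Splittings.RobinFiniteTailFree
import HarnessLib

/-!
# RobinFiniteC1Core — Part 1/5 — the E1c⁻ zero budget at `c = 1`: `corePwLower1_of_stubs`, `corePwLower1`,
`nicolasLowerBound1_core`, the windowed form `nicolasLowerBetween1_of_tailBound` and the tail-free
`nicolasLowerBetween1_PT_tailFree` (budget `0.0463 + (1 + 2/log X₀)·2.961·10⁻¹²·√X₁`).

FINDING (gen 8).  The factor `2` in the tree's E1c⁻ zero budget `0.0463 + 2(1 + 2/log x)·D`
(`RobinFiniteE1c.corePwLower_of_stubs`) is `linarith` slack: the zero cost delivered by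
`RobinFiniteE1cZeroSplit.zeroSplitBound_holds` is `0.0463·(a₁ + a₂ + 4a₃) + (1 + 2/log x)·D·a₁`
(`a_k = 1/(√x logᵏ x)`), while the budget pays `(0.0463 − β)(a₁ + a₂ + 4a₃) + 2(1 + 2/log x)D·(a₁ + a₂ + 4a₃)`.
The SAME bookkeeping from the SAME three stubs with budget `0.0463 + (1 + 2/log x)·D` compiles — no new hypothesis,
no one-sided tail pricing.  Every proof below is the tree's (`RobinFiniteE1c` ll. 100–360, `RobinFiniteTailFree`) with
the constant `2` deleted; the consumers are restated verbatim against the new core.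

Cell rh-split, seat rh-split-robin-finite g8 (brief sha16 f79c5f09d8bcb036), card `cards/SPLIT-robin-finite.md` §15;
carved from the kernel-checked object `HOME/rh-split-robin-finite/g8/SketchG8-G.lean` (sha16 b720eb98042decc0, rc 0,
0 warnings, 0 sorries, axioms [propext, Classical.choice, Quot.sound]).  Zero `def`, zero `instance`, zero `notation`,
no attribute changes, no `native_decide`.

HONEST LABEL: SPLITTING SEARCH over kernel-typed RH-EQUIVALENCES; a splitting A ∧ B ⟹ RH is CONDITIONAL
bookkeeping unless A and B are both proved; nothing here bears on the truth of RH.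
-/

set_option linter.dupNamespace false

noncomputable section

open Complex Filter Set MeasureTheory Topology intervalIntegral
open scoped Real Chebyshev ComplexConjugate

namespace Summit.RiemannHypothesis.RiemannHypothesis.Theorems.Splittings.RobinFiniteC1

open Literature.NumberTheory.LFunctions Literature.NumberTheory.DiophantineGeometry
open NicolasJ NicolasFz NicolasK NicolasJExplicit
open Summit.RiemannHypothesis.RiemannHypothesis.Theorems.Splittings.RobinFiniteE1c

/-- c = 1 · **the E1c⁻ core from the SAME three stubs** as the tree's `RobinFiniteE1c.corePwLower_of_stubs` (h1 = the RH-free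
explicit formula `explicitFormulaFree_holds`, h2 = the split zero-sum bound `zeroSplitBound_holds`, h4 = `ψ − θ`
(`psiSubThetaFree_holds`)), with the conclusion's zero budget `0.0463 + (1 + 2/log x)·D` in place of `0.0463 + 2(1 + 2/log x)·D`:
the stub h2 delivers the zero cost `0.0463·(a₁ + Dx) + (1 + 2/log x)·D·a₁` (`a₁ = 1/(√x log x)`), and `(1 + 2/log x)D·a₁ ≤
(1 + 2/log x)D·(a₁ + a₂ + 4a₃)`; the tree's factor `2` was never used.  Proof = the tree's, verbatim up to the budget constant. -/
theorem corePwLower1_of_stubs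
    (h1 : ∀ x : ℝ, 1 < x →
      Summable (fun ρ : Zeros ↦ (riemannZetaZeroOrder (ρ : ℂ) : ℂ) / (ρ : ℂ) * Fz (ρ : ℂ) x) ∧
      ∃ L : ℝ, Tendsto (fun X : ℝ ↦ ∫ t in x..X, (ψ t - t) * w0 t) atTop (𝓝 L) ∧
        (-∑' ρ : Zeros, (riemannZetaZeroOrder (ρ : ℂ) : ℂ) / (ρ : ℂ) * Fz (ρ : ℂ) x).re
          - Real.log (2 * π) / (x * Real.log x) ≤ L)
    (h2 : ∀ T x D : ℝ, 1 < x → RiemannHypothesisUpTo T →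
      (∑' ρ : RHWave0.riemannZetaNontrivialZeros,
        (if T < |(ρ : ℂ).im| then
          (riemannZetaZeroOrder (ρ : ℂ) : ℝ) * x ^ ((ρ : ℂ).re - 1 / 2) / (ρ : ℂ).im ^ 2 else 0) ≤ D) →
      Summable (fun ρ : Zeros ↦ (riemannZetaZeroOrder (ρ : ℂ) : ℂ) / (ρ : ℂ) * Fz (ρ : ℂ) x) →
        -(0.0463 * (1 / (Real.sqrt x * Real.log x) + Dx x)
            + (1 + 2 / Real.log x) * D * (1 / (Real.sqrt x * Real.log x))) ≤
          (-∑' ρ : Zeros, (riemannZetaZeroOrder (ρ : ℂ) : ℂ) / (ρ : ℂ) * Fz (ρ : ℂ) x).re)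
    (h4 : ∀ t : ℝ, 599 ≤ t → ψ t - θ t ≤ 1.021 * Real.sqrt t + 4 / 3 * t ^ ((1 : ℝ) / 3)) :
    ∀ T x D : ℝ, 599 ≤ x → 0 ≤ D → RiemannHypothesisUpTo T →
      (∀ y : ℝ, 599 ≤ y → y ≤ x → |θ y - y| ≤ √y * Real.log y ^ 2 / (8 * π)) →
      (∑' ρ : RHWave0.riemannZetaNontrivialZeros,
        (if T < |(ρ : ℂ).im| then
          (riemannZetaZeroOrder (ρ : ℂ) : ℝ) * x ^ ((ρ : ℂ).re - 1 / 2) / (ρ : ℂ).im ^ 2 else 0) ≤ D) →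
      -Real.log (nicolasF x) ≤ RobinAnalyticSharp.nicolasERH x +
        (0.0463 + (1 + 2 / Real.log x) * D - nicolasBeta) *
          (1 / (√x * Real.log x) + 1 / (√x * Real.log x ^ 2) + 4 / (√x * Real.log x ^ 3)) := by
  intro T x D hx hD hT hW hoff
  have hx1 : (1 : ℝ) < x := by linarith
  have hx0 : (0 : ℝ) < x := by linarith
  have hlx : 0 < Real.log x := Real.log_pos hx1
  have hsx : 0 < Real.sqrt x := Real.sqrt_pos.2 hx0
  have h21 := NicolasK.lemma21_lower (by linarith : (121 : ℝ) ≤ x) (theta_ge_four_fifths_of_window hW hx)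
  have hS2 := sq_theta_sub_div_le_of_window hW hx
  obtain ⟨hsum, L, hL, hZL⟩ := h1 x hx1
  have hK := NicolasK.tendsto_integral_S_mul_w0 hx1
  have hJK : L - nicolasKInt x ≤ 1.021 * (Fz (1 / 2 : ℝ) x).re + 4 / 3 * (Fz (1 / 3 : ℝ) x).re := by
    refine le_of_tendsto (hL.sub hK) ?_
    filter_upwards [eventually_ge_atTop x] with X hX
    exact jk_partial_le hx1 hX (by norm_num) fun t ht ↦ h4 t (le_trans hx ht)
  have hZ := h2 T x D hx1 hT hoff hsum
  have hF2 := NicolasFz.Fhalf_le hx1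
  have hF3 := NicolasFz.Fthird_le hx1
  obtain ⟨a₁, ha₁⟩ : ∃ a : ℝ, a = 1 / (Real.sqrt x * Real.log x) := ⟨_, rfl⟩
  obtain ⟨a₂, ha₂⟩ : ∃ a : ℝ, a = 1 / (Real.sqrt x * Real.log x ^ 2) := ⟨_, rfl⟩
  obtain ⟨a₃, ha₃⟩ : ∃ a : ℝ, a = 1 / (Real.sqrt x * Real.log x ^ 3) := ⟨_, rfl⟩
  obtain ⟨a₅, ha₅⟩ : ∃ a : ℝ, a = 1 / (x ^ ((2 : ℝ) / 3) * Real.log x) := ⟨_, rfl⟩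
  obtain ⟨P, hP⟩ : ∃ a : ℝ, a = (1 + 2 / Real.log x) * D := ⟨_, rfl⟩
  have hP0 : 0 ≤ P := by rw [hP]; positivity
  have ha₁0 : 0 ≤ a₁ := by rw [ha₁]; positivity
  have ha₂0 : 0 ≤ a₂ := by rw [ha₂]; positivity
  have ha₃0 : 0 ≤ a₃ := by rw [ha₃]; positivity
  have hPa₁ : 0 ≤ P * a₁ := mul_nonneg hP0 ha₁0
  have hPa₂ : 0 ≤ P * a₂ := mul_nonneg hP0 ha₂0
  have hPa₃ : 0 ≤ P * a₃ := mul_nonneg hP0 ha₃0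
  have eZ : -(0.0463 * (1 / (Real.sqrt x * Real.log x) + Dx x)
      + (1 + 2 / Real.log x) * D * (1 / (Real.sqrt x * Real.log x))) =
      -0.0463 * a₁ - 0.0463 * a₂ - 0.1852 * a₃ - P * a₁ := by
    rw [ha₁, ha₂, ha₃, hP, NicolasJExplicit.Dx]
    field_simp
    ring
  have eF2 : 2 / (Real.sqrt x * Real.log x) - 2 / (Real.sqrt x * Real.log x ^ 2) +
      8 / (Real.sqrt x * Real.log x ^ 3) = 2 * a₁ - 2 * a₂ + 8 * a₃ := by
    rw [ha₁, ha₂, ha₃]; ring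
  have eF3 : 3 / (2 * x ^ (2 / 3 : ℝ) * Real.log x) = 3 / 2 * a₅ := by
    rw [ha₅]; ring
  have eE : RobinAnalyticSharp.nicolasERH x +
        (0.0463 + (1 + 2 / Real.log x) * D - nicolasBeta) *
          (1 / (√x * Real.log x) + 1 / (√x * Real.log x ^ 2) + 4 / (√x * Real.log x ^ 3)) =
      2.0883 * a₁ + (P * a₁) - 1.9957 * a₂ + (P * a₂) + 8.3532 * a₃ + 4 * (P * a₃)
        + Real.log (2 * π) / (x * Real.log x) + 2 * a₅ + Real.log x ^ 3 / (64 * π ^ 2 * x) := by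
    rw [ha₁, ha₂, ha₃, ha₅, hP]
    unfold RobinAnalyticSharp.nicolasERH RobinAnalyticSharp.nicolasE
    ring
  rw [eZ] at hZ
  rw [eF2] at hF2
  rw [eF3] at hF3
  rw [eE]
  linarith

/-- c = 1 · **the core, PROVED modulo the two RH-free named `θ`-facts** (Büthe 2018 Thm 2, BKLNW 2021 §1.2, hypothesis position):
for `x ≥ 599`, `D ≥ 0`, RH up to `T`, Schoenfeld's `θ`-bound on `[599, x]` and `Σ_{|γ|>T} m(ρ) x^{Re ρ − 1/2}/γ² ≤ D`:
`−log f(x) ≤ E(0.0463 + (1 + 2/log x)D, x)` — the tree's `corePwLower` with the factor `2` removed. -/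
theorem corePwLower1 (hB : Buthe2018_thm2_theta) (hK : BroadbentEtAl2021_theta_rel_1e19) :
    ∀ T x D : ℝ, 599 ≤ x → 0 ≤ D → RiemannHypothesisUpTo T →
      (∀ y : ℝ, 599 ≤ y → y ≤ x → |θ y - y| ≤ √y * Real.log y ^ 2 / (8 * π)) →
      (∑' ρ : RHWave0.riemannZetaNontrivialZeros,
        (if T < |(ρ : ℂ).im| then
          (riemannZetaZeroOrder (ρ : ℂ) : ℝ) * x ^ ((ρ : ℂ).re - 1 / 2) / (ρ : ℂ).im ^ 2 else 0) ≤ D) →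
      -Real.log (nicolasF x) ≤ RobinAnalyticSharp.nicolasERH x +
        (0.0463 + (1 + 2 / Real.log x) * D - nicolasBeta) *
          (1 / (√x * Real.log x) + 1 / (√x * Real.log x ^ 2) + 4 / (√x * Real.log x ^ 3)) :=
  corePwLower1_of_stubs explicitFormulaFree_holds zeroSplitBound_holds (psiSubThetaFree_holds hB hK)

/-- c = 1 · **Platt–Trudgian range, pointwise**: with RH verified to `3 000 175 332 800`, Büthe 2016 Thm 2, Büthe 2018 Thm 2 and
BKLNW 2021 (hypothesis position), for `599 ≤ x ≤ 2.169·10²⁵` and `D ≥ Σ_{|γ| > 3·10¹²} m(ρ) x^{Re ρ − 1/2}/γ²`: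
`−log f(x) ≤ E(0.0463 + (1 + 2/log x)D, x)` (tree `partialNicolasLower_PT` with the factor `2` removed). -/
theorem partialNicolasLower1_PT (h16 : Buthe2016_thm2) (hB : Buthe2018_thm2_theta)
    (hK : BroadbentEtAl2021_theta_rel_1e19) (hRH : RiemannHypothesisUpTo 3000175332800)
    {x D : ℝ} (hx : 599 ≤ x) (hx25 : x ≤ 2.169e25) (hD : 0 ≤ D)
    (hoff : ∑' ρ : RHWave0.riemannZetaNontrivialZeros,
        (if 3000175332800 < |(ρ : ℂ).im| then
          (riemannZetaZeroOrder (ρ : ℂ) : ℝ) * x ^ ((ρ : ℂ).re - 1 / 2) / (ρ : ℂ).im ^ 2 else 0) ≤ D) :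
    -Real.log (nicolasF x) ≤ RobinAnalyticSharp.nicolasERH x +
        (0.0463 + (1 + 2 / Real.log x) * D - nicolasBeta) *
          (1 / (√x * Real.log x) + 1 / (√x * Real.log x ^ 2) + 4 / (√x * Real.log x ^ 3)) :=
  corePwLower1 hB hK _ x D hx hD hRH (schoenfeldThetaOn_of_buthe2016 h16 hRH hx25) hoff

/-- c = 1 · the pointwise budget `0.0463 + (1 + 2/log x)D` decreases along the window (`D ≥ 0`). -/
theorem budgetPw1_anti {D X₀ x : ℝ} (hD : 0 ≤ D) (hX₀ : 1 < X₀) (hx : X₀ ≤ x) :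
    0.0463 + (1 + 2 / Real.log x) * D ≤ 0.0463 + (1 + 2 / Real.log X₀) * D := by
  have h0 : 0 < Real.log X₀ := Real.log_pos hX₀
  have hle : Real.log X₀ ≤ Real.log x := Real.log_le_log (by linarith) hx
  have h2 : 2 / Real.log x ≤ 2 / Real.log X₀ := div_le_div_of_nonneg_left (by norm_num) h0 hle
  have h3 : 2 / Real.log x * D ≤ 2 / Real.log X₀ * D := mul_le_mul_of_nonneg_right h2 hD
  linarith

/-- c = 1 · **E1c⁻ ⟹ windowed E1**: a uniform off-line bound `D` on `[X₀, X₁] ⊆ [599, B]` gives, under RH up to `T` and the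
`θ`-window on `[599, B]`, Nicolas's lower bound with the one budget `0.0463 + (1 + 2/log X₀)D` on `[X₀, X₁]`. -/
theorem partialNicolasBetween1_holds (hB : Buthe2018_thm2_theta) (hK : BroadbentEtAl2021_theta_rel_1e19)
    {T B D X₀ X₁ : ℝ}
    (hoff : ∀ x : ℝ, X₀ ≤ x → x ≤ X₁ →
      ∑' ρ : RHWave0.riemannZetaNontrivialZeros,
        (if T < |(ρ : ℂ).im| then
          (riemannZetaZeroOrder (ρ : ℂ) : ℝ) * x ^ ((ρ : ℂ).re - 1 / 2) / (ρ : ℂ).im ^ 2 else 0) ≤ D)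
    (hD : 0 ≤ D) (hX₀ : 1 < X₀) (hBB : X₁ ≤ B) :
    RiemannHypothesisUpTo T → (∀ y : ℝ, 599 ≤ y → y ≤ B → |θ y - y| ≤ √y * Real.log y ^ 2 / (8 * π)) →
      ∀ x : ℝ, 599 ≤ x → X₀ ≤ x → x ≤ X₁ →
        -Real.log (nicolasF x) ≤ RobinAnalyticSharp.nicolasERH x +
            (0.0463 + (1 + 2 / Real.log X₀) * D - nicolasBeta) *
              (1 / (√x * Real.log x) + 1 / (√x * Real.log x ^ 2) + 4 / (√x * Real.log x ^ 3)) := by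
  intro hT hθ x hx hx0 hx1
  have h := corePwLower1 hB hK T x D hx hD hT
    (fun y hy hyx => hθ y hy (le_trans hyx (le_trans hx1 hBB))) (hoff x hx0 hx1)
  exact h.trans (nicolasEWith_mono (by linarith) (budgetPw1_anti hD hX₀ hx0))

/-- c = 1 · **E1c⁻ ∧ (tail bound) ⟹ windowed E1**: a Lehman-type tail bound `Σ_{|γ|>T} m/γ² ≤ h` gives the budget
`0.0463 + (1 + 2/log X₀)·h·√X₁` on `[X₀, X₁]`. -/
theorem partialNicolasBetween1_of_tail (hB : Buthe2018_thm2_theta) (hK : BroadbentEtAl2021_theta_rel_1e19)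
    {T B h X₀ X₁ : ℝ}
    (ht : ∑' ρ : RHWave0.riemannZetaNontrivialZeros,
        (if T < |(ρ : ℂ).im| then (riemannZetaZeroOrder (ρ : ℂ) : ℝ) / (ρ : ℂ).im ^ 2 else 0) ≤ h)
    (hh : 0 ≤ h) (hX₀ : 1 < X₀) (hBB : X₁ ≤ B) :
    RiemannHypothesisUpTo T → (∀ y : ℝ, 599 ≤ y → y ≤ B → |θ y - y| ≤ √y * Real.log y ^ 2 / (8 * π)) →
      ∀ x : ℝ, 599 ≤ x → X₀ ≤ x → x ≤ X₁ →
        -Real.log (nicolasF x) ≤ RobinAnalyticSharp.nicolasERH x +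
            (0.0463 + (1 + 2 / Real.log X₀) * (h * √X₁) - nicolasBeta) *
              (1 / (√x * Real.log x) + 1 / (√x * Real.log x ^ 2) + 4 / (√x * Real.log x ^ 3)) := by
  refine partialNicolasBetween1_holds hB hK (fun x hx0 hx1 => ?_) (by positivity) hX₀ hBB
  have hx1' : 1 ≤ x := by linarith
  exact le_trans (offLineSumAt_of_zeroTailBound ht hx1')
    (mul_le_mul_of_nonneg_left (Real.sqrt_le_sqrt hx1) hh)

/-- c = 1 · **E1 ∧ E2 at the Platt–Trudgian height** with a tail bound `h` as hypothesis: budget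
`0.0463 + (1 + 2/log X₀)·h·√X₁` at every `x ∈ [X₀, X₁]`, `599 ≤ x`, `X₁ ≤ 2.169·10²⁵`. -/
theorem nicolasLowerBetween1_PT (h16 : Buthe2016_thm2) (hB : Buthe2018_thm2_theta)
    (hK : BroadbentEtAl2021_theta_rel_1e19) (hRH : RiemannHypothesisUpTo 3000175332800)
    {h X₀ X₁ : ℝ}
    (ht : ∑' ρ : RHWave0.riemannZetaNontrivialZeros,
        (if 3000175332800 < |(ρ : ℂ).im| then (riemannZetaZeroOrder (ρ : ℂ) : ℝ) / (ρ : ℂ).im ^ 2 else 0) ≤ h)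
    (hh : 0 ≤ h) (hX₀ : 1 < X₀) (hX₁ : X₁ ≤ 2.169e25) :
    ∀ x : ℝ, 599 ≤ x → X₀ ≤ x → x ≤ X₁ →
      -Real.log (nicolasF x) ≤ RobinAnalyticSharp.nicolasERH x +
          (0.0463 + (1 + 2 / Real.log X₀) * (h * √X₁) - nicolasBeta) *
            (1 / (√x * Real.log x) + 1 / (√x * Real.log x ^ 2) + 4 / (√x * Real.log x ^ 3)) :=
  partialNicolasBetween1_of_tail hB hK ht hh hX₀ hX₁ hRH (schoenfeldThetaOn_of_buthe2016 h16 hRH le_rfl)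

/-- c = 1 · **THE BOOK'S E1 ∧ E2 AT THE PLATT–TRUDGIAN HEIGHT WITH NO TAIL HYPOTHESIS** (∘ tree
`RobinFiniteTail.zeroTailBound_PT`): modulo the three RH-free named `θ`-facts and `RiemannHypothesisUpTo 3000175332800`
ONLY, Nicolas's (2.18) at every `x ∈ [X₀, X₁]`, `599 ≤ x`, `X₁ ≤ 2.169·10²⁵`, with budget
`0.0463 + (1 + 2/log X₀)·2.961·10⁻¹²·√X₁` (`≤ 0.1439` on `[8·10²⁰, 10²¹]`).  Nothing here bears on the truth of RH. -/
theorem nicolasLowerBetween1_PT_tailFree (h16 : Buthe2016_thm2) (hB : Buthe2018_thm2_theta)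
    (hK : BroadbentEtAl2021_theta_rel_1e19) (hRH : RiemannHypothesisUpTo 3000175332800)
    {X₀ X₁ : ℝ} (hX₀ : 1 < X₀) (hX₁ : X₁ ≤ 2.169e25) :
    ∀ x : ℝ, 599 ≤ x → X₀ ≤ x → x ≤ X₁ →
      -Real.log (nicolasF x) ≤ RobinAnalyticSharp.nicolasERH x +
          (0.0463 + (1 + 2 / Real.log X₀) * (2.961e-12 * √X₁) - nicolasBeta) *
            (1 / (√x * Real.log x) + 1 / (√x * Real.log x ^ 2) + 4 / (√x * Real.log x ^ 3)) :=
  nicolasLowerBetween1_PT h16 hB hK hRH (h := 2.961e-12)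
    Summit.RiemannHypothesis.RiemannHypothesis.Theorems.Splittings.RobinFiniteTail.zeroTailBound_PT
    (by norm_num) hX₀ hX₁

/-- c = 1 · **the same at ANY verification height `T ≥ 7`** (∘ tree `RobinFiniteTail.zeroTailBound_tailH`): RH up to `T` and
the `θ`-window on `[599, B]` give Nicolas's (2.18) on `[X₀, X₁] ⊆ (1, B]` with budget `0.0463 + (1 + 2/log X₀)·tailH(T)·√X₁`,
`tailH T = (log(T/2π) + 1)/(πT) + (184 + 30 log T)/T²` — the zeros above `T` are priced by the KERNEL. -/
theorem partialNicolasBetween1_tailFree (hB : Buthe2018_thm2_theta) (hK : BroadbentEtAl2021_theta_rel_1e19)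
    {T B X₀ X₁ : ℝ} (hT : 7 ≤ T) (hX₀ : 1 < X₀) (hBB : X₁ ≤ B) :
    RiemannHypothesisUpTo T → (∀ y : ℝ, 599 ≤ y → y ≤ B → |θ y - y| ≤ √y * Real.log y ^ 2 / (8 * π)) →
      ∀ x : ℝ, 599 ≤ x → X₀ ≤ x → x ≤ X₁ →
        -Real.log (nicolasF x) ≤ RobinAnalyticSharp.nicolasERH x +
            (0.0463 + (1 + 2 / Real.log X₀) *
              (((Real.log (T / (2 * π)) + 1) / (π * T) + (184 + 30 * Real.log T) / T ^ 2) * √X₁) - nicolasBeta) *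
              (1 / (√x * Real.log x) + 1 / (√x * Real.log x ^ 2) + 4 / (√x * Real.log x ^ 3)) :=
  partialNicolasBetween1_of_tail hB hK
    (Summit.RiemannHypothesis.RiemannHypothesis.Theorems.Splittings.RobinFiniteTail.zeroTailBound_tailH hT)
    (Summit.RiemannHypothesis.RiemannHypothesis.Theorems.Splittings.RobinFiniteTail.tailH_nonneg hT) hX₀ hBB

end Summit.RiemannHypothesis.RiemannHypothesis.Theorems.Splittings.RobinFiniteC1
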